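import Summits.BirchSwinnertonDyer.BirchSwinnertonDyer.Theses.KatoDescentPotSupersingular
import Summits.BirchSwinnertonDyer.BirchSwinnertonDyer.Theorems.KatoDescentPotSupersingularWildUpperReducibleOfCountInputs
import HarnessLib

/-!
# Route `KatoDescentPotSupersingular` (rung K9, cell `bsd-potss`): CLOSER of the generated glue
# `WildUpperReducibleDefectOfCountInputs` (item stmt-BirchSwinnertonDyer-19711)

The planner's glued split (plan g15, K9 rev 15) of the crux U₀-red `WildUpperReducibleDefect`
(item 19190) into six HELD by-name alias children — `PublishedInputIwasawaH1DataRed`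
(`Kato2004.nonempty_iwasawaH1Data`), `PublishedInputNewformKatoRed` (`ModularForms.exists_isNewformOf`),
`PublishedInputMemberHullCountInputs` (`Kato2004.exists_memberHullCountInputs`, the reviewed sharp
member count p448371), `PublishedInputCasselsIsogenyRed` (`bsdRHS_eq_of_isIsogenous`),
`PublishedInputRankEqAnalyticRankRed` (`rank_eq_analyticRank_of_analyticRank_le_one`),
`PublishedInputEntireLFunctionRed` (`hasEntireLFunction_rat`) — plus the glue
`C₁ → … → C₆ → WildUpperReducibleDefect`.  The glue is proved here by seat kmc g9's accepted closer
`Theorems.wildUpperReducibleDefect_of_memberCountInputs` (p451820, over the route-free node file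
`KatoDescentPotSupersingularReducibleUpperOfCountInputsNodes.lean`): the six alias decls are
`Sort 0`/`Prop` ascriptions of exactly its six hypotheses, so the proof is definitional application
(planner sketch certified rc 0: HOME `plan/edit-g15/K9red/SplitSketch.lean`).

HONEST FRAMING: this is bookkeeping over a landed theorem — the U₀-red content (Kato's Euler-system
count read EXACTLY at his member of a reducible wild class, Cassels-transported) is unchanged and rests
on the named transcription `exists_memberHullCountInputs` (review flag
`Kato-14.9.3-count-Af-symbolic-member-reducible`) and the classical named facts; BSD is not advanced;
«closes glue leaf 19711 of rung K9 of BirchSwinnertonDyer», never summit credit.  Filed by seat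
`bsd-potss-k9-c2` generation 7 at the planner's 16:27:16Z «closers wanted, any seat» call.

References: [Kato2004Asterisque] (14.9.3) (p. 240), proof of Prop. 14.16 (pp. 244–245), Thm. 12.6
(p. 222); [GreenbergLNM1716] §3; [Cassels1965ArithmeticVIII]; [MilneADT2006] Thm. I.7.3.
-/

set_option autoImplicit false
-- sibling precedent (`KatoDescentPotSupersingularAssembly.lean`): the directory name repeats the summit name
set_option linter.dupNamespace false

namespace Summit.BirchSwinnertonDyer.BirchSwinnertonDyer.Theorems

/-- **Glue 19711 `WildUpperReducibleDefectOfCountInputs` holds**: the six held published inputs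
(Kato's 𝐇¹ data, modularity as a newform, Kato's sharp member count inputs, Cassels' isogeny
invariance, GZK, modularity as an entire L-function) imply the crux U₀-red `WildUpperReducibleDefect`
— by `wildUpperReducibleDefect_of_memberCountInputs` (kmc g9, p451820), whose hypotheses the six
alias decls ascribe verbatim.  Type = the route decl by name.
[cite: Kato2004Asterisque, proof of Prop. 14.16 (pp. 244–245) and Thm. 12.6 (p. 222)]
[cite: Cassels1965ArithmeticVIII] -/
theorem wildUpperReducibleDefectOfCountInputs_proof :
    Summit.BirchSwinnertonDyer.BirchSwinnertonDyer.Theses.KatoDescentPotSupersingular.WildUpperReducibleDefectOfCountInputs :=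
  fun h₁ h₂ h₃ h₄ h₅ h₆ =>
    Summit.BirchSwinnertonDyer.BirchSwinnertonDyer.Theorems.wildUpperReducibleDefect_of_memberCountInputs
      h₁ h₂ h₃ h₄ h₅ h₆

end Summit.BirchSwinnertonDyer.BirchSwinnertonDyer.Theorems
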